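import Summits.NavierStokesRegularity.NavierStokesRegularity.Theorems.HodographBetchovClassBudgetsRegulariseSlice
import Literature.Analysis.FluidPDE.TaoLocalisationProofs
import Literature.Analysis.FluidPDE.NSVorticityBKMContinuation

/-!
# Crux `HodographBetchov.ClassBudgetsRegularise` (stmt-NavierStokesRegularity-16863), line `birth` —
# the class-budget enstrophy Grönwall on a closed slab in Tao's class (helper for stub 1)

For a classical solution `(u, p)` of unforced Navier–Stokes (`ν > 0`) on the closed slab
`[0, T] × ℝ³` in Tao's `L²`-Sobolev class (`u, ∂ₜu, p ∈ L^∞_t H^k_x`) and a speed level `l > 0`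
carrying both CLASS BUDGETS — (slow) `P = ⟪ω, ∇u ω⟫` integrable on `S_T = {0 < s < T, ‖u‖ ≤ l}`
with `∫_{S_b} P ≤ C` for `0 < b ≤ T`; (fast) a nonnegative two-frame majorant `m` of the middle
strain eigenvalue on `{l < ‖u‖}` with `Λ = ∫₀ᵀ (∫_{l<‖u(t)‖} m(t)^r)^{2/(2r−3)} dt < ∞`, `r > 3/2` —
`classBudget_enstrophy_slab` gives `∫|∇u(s)|²_F ≤ (∫|∇u(0)|²_F + 1 + 2C⁺) exp((2κ + 1) Λ)` on
`[0, T]`, `κ = θ(2(1−θ))^{(1−θ)/θ} ν^{−(1−θ)/θ} (2 K_S^{2(1−θ)})^{1/θ}`, `θ = 1 − 3/(2r)`: Miller's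
enstrophy bound (Thm. 1.1) localised to the fast velocity class. Proof: enstrophy balance
(`IsSmoothSpaceTimeOn.enstrophy_balance`), the class ledger at every interior time
(`classLedger_slice`), Fubini on the slow class (`slowClass_fubini`), and Grönwall's lemma with the
`ℝ≥0∞`-valued, possibly non-measurable kernel `(2κ+1)A` (`lintegral_gronwall_le`), run for
`G + 1` so that the slice inequality holds at EVERY time (trivially where `A(t) = ∞`).

References: Miller, ARMA 235 (2020), Thm. 1.1; Lemarié-Rieusset (2016), Thm. 11.2; RRS (2016), Lemma A.25.
-/

noncomputable section

open MeasureTheory Set Function Filter Topology InnerProductSpace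
open scoped ENNReal NNReal ContDiff RealInnerProductSpace Laplacian

set_option linter.dupNamespace false -- summit and sub-problem share the name (CONVENTIONS §1)

namespace Summit.NavierStokesRegularity.NavierStokesRegularity.Theorems.ClassBudgetsRegularise

open Literature.Analysis Literature.Analysis.FluidPDE

/-- **Fubini for the slow class** `S_T = {0 < s < T, ‖u‖ ≤ l}` of a field jointly continuous on
`[0, T] × ℝ³`: `∫_{S_b} P = ∫₀ᵇ (∫_{‖u(t)‖ ≤ l} P(t)) dt` for `0 < b ≤ T`, the inner slow integral being
integrable on `(0, T)`. [folklore] -/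
theorem slowClass_fubini {T : ℝ}
    {u : ℝ → EuclideanSpace ℝ (Fin 3) → EuclideanSpace ℝ (Fin 3)}
    (hcont : ContinuousOn (uncurry u) (Icc 0 T ×ˢ univ))
    {P : ℝ × EuclideanSpace ℝ (Fin 3) → ℝ} {l : ℝ}
    (hI : IntegrableOn P {z : ℝ × EuclideanSpace ℝ (Fin 3) | z.1 ∈ Ioo 0 T ∧ ‖u z.1 z.2‖ ≤ l}) :
    IntegrableOn (fun t => ∫ x in {x | ‖u t x‖ ≤ l}, P (t, x)) (Ioo 0 T) ∧
    ∀ b ∈ Ioc 0 T, ∫ z in {z : ℝ × EuclideanSpace ℝ (Fin 3) | z.1 ∈ Ioo 0 b ∧ ‖u z.1 z.2‖ ≤ l}, P z =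
      ∫ t in Ioo 0 b, ∫ x in {x | ‖u t x‖ ≤ l}, P (t, x) := by
  -- measurability of the slow classes
  have hmeasS : ∀ b, b ≤ T → MeasurableSet {z : ℝ × EuclideanSpace ℝ (Fin 3) | z.1 ∈ Ioo 0 b ∧ ‖u z.1 z.2‖ ≤ l} := by
    intro b hb
    have hO : IsOpen (Ioo (0 : ℝ) b ×ˢ (univ : Set (EuclideanSpace ℝ (Fin 3)))) := isOpen_Ioo.prod isOpen_univ
    have hc : ContinuousOn (fun z : ℝ × EuclideanSpace ℝ (Fin 3) => ‖uncurry u z‖) (Ioo 0 b ×ˢ univ) :=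
      (hcont.mono (prod_mono (Ioo_subset_Icc_self.trans (Icc_subset_Icc le_rfl hb)) Subset.rfl)).norm
    have hopen : IsOpen ((Ioo (0 : ℝ) b ×ˢ (univ : Set (EuclideanSpace ℝ (Fin 3)))) ∩
        (fun z => ‖uncurry u z‖) ⁻¹' Ioi l) := hc.isOpen_inter_preimage hO isOpen_Ioi
    have heq : {z : ℝ × EuclideanSpace ℝ (Fin 3) | z.1 ∈ Ioo 0 b ∧ ‖u z.1 z.2‖ ≤ l} =
        (Ioo (0 : ℝ) b ×ˢ (univ : Set (EuclideanSpace ℝ (Fin 3)))) \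
          ((Ioo (0 : ℝ) b ×ˢ univ) ∩ (fun z => ‖uncurry u z‖) ⁻¹' Ioi l) := by
      ext z
      simp only [mem_setOf_eq, Set.mem_sdiff, mem_prod, mem_univ, and_true, mem_inter_iff, mem_preimage,
        mem_Ioi, uncurry, not_and, not_lt]
      constructor
      · rintro ⟨h1, h2⟩; exact ⟨h1, fun _ => h2⟩
      · rintro ⟨h1, h2⟩; exact ⟨h1, h2 h1⟩
    rw [heq]
    exact hO.measurableSet.diff hopen.measurableSet
  have hmeasSx : ∀ t ∈ Icc 0 T, MeasurableSet {x : EuclideanSpace ℝ (Fin 3) | ‖u t x‖ ≤ l} := by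
    intro t ht
    have hc : Continuous (u t) := by
      have h1 : ContinuousOn (uncurry u ∘ fun x : EuclideanSpace ℝ (Fin 3) => (t, x)) univ :=
        hcont.comp (continuous_const.prodMk continuous_id).continuousOn
          (fun x _ => mk_mem_prod ht (mem_univ x))
      exact continuousOn_univ.1 h1
    exact (isClosed_le hc.norm continuous_const).measurableSet
  -- the indicator algebra
  set S : ℝ → Set (ℝ × EuclideanSpace ℝ (Fin 3)) := fun b =>
    {z | z.1 ∈ Ioo 0 b ∧ ‖u z.1 z.2‖ ≤ l} with hS
  have hind : ∀ b t x, (S b).indicator P (t, x) =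
      (Ioo 0 b).indicator (fun t => ({x : EuclideanSpace ℝ (Fin 3) | ‖u t x‖ ≤ l}).indicator
        (fun x => P (t, x)) x) t := by
    intro b t x
    by_cases ht : t ∈ Ioo 0 b
    · by_cases hx : ‖u t x‖ ≤ l
      · rw [indicator_of_mem (show (t, x) ∈ S b from ⟨ht, hx⟩), indicator_of_mem ht,
          indicator_of_mem (show x ∈ {x : EuclideanSpace ℝ (Fin 3) | ‖u t x‖ ≤ l} from hx)]
      · rw [indicator_of_notMem (show (t, x) ∉ S b from fun h => hx h.2), indicator_of_mem ht,
          indicator_of_notMem (show x ∉ {x : EuclideanSpace ℝ (Fin 3) | ‖u t x‖ ≤ l} from hx)]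
    · rw [indicator_of_notMem (show (t, x) ∉ S b from fun h => ht h.1), indicator_of_notMem ht]
  have hinner : ∀ b, b ≤ T → ∀ t, ∫ x, (S b).indicator P (t, x) =
      (Ioo 0 b).indicator (fun t => ∫ x in {x | ‖u t x‖ ≤ l}, P (t, x)) t := by
    intro b hb t
    simp_rw [hind b t]
    by_cases ht : t ∈ Ioo 0 b
    · rw [indicator_of_mem ht]
      simp only [indicator_of_mem ht]
      exact integral_indicator (hmeasSx t ⟨ht.1.le, ht.2.le.trans hb⟩)
    · simp only [indicator_of_notMem ht, integral_zero]
  -- integrability on the product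
  have hvol : (volume : Measure (ℝ × EuclideanSpace ℝ (Fin 3))) =
      (volume : Measure ℝ).prod (volume : Measure (EuclideanSpace ℝ (Fin 3))) := rfl
  have hIb : ∀ b, b ≤ T → Integrable ((S b).indicator P)
      ((volume : Measure ℝ).prod (volume : Measure (EuclideanSpace ℝ (Fin 3)))) := by
    intro b hb
    rw [← hvol, integrable_indicator_iff (hmeasS b hb)]
    exact hI.mono_set fun z hz => ⟨⟨hz.1.1, hz.1.2.trans_le hb⟩, hz.2⟩
  refine ⟨?_, fun b hb => ?_⟩
  · -- integrability of the inner slow integral on `(0, T)`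
    have h := (hIb T le_rfl).integral_prod_left
    have heq : (fun t => ∫ x, (S T).indicator P (t, x)) =
        (Ioo 0 T).indicator (fun t => ∫ x in {x | ‖u t x‖ ≤ l}, P (t, x)) := by
      funext t; exact hinner T le_rfl t
    rw [heq, integrable_indicator_iff measurableSet_Ioo] at h
    exact h
  · -- Fubini on `S_b`
    rw [← integral_indicator (hmeasS b hb.2), hvol, integral_prod _ (hIb b hb.2)]
    have heq : (fun t => ∫ x, (S b).indicator P (t, x)) =
        (Ioo 0 b).indicator (fun t => ∫ x in {x | ‖u t x‖ ≤ l}, P (t, x)) := by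
      funext t; exact hinner b hb.2 t
    change ∫ t, (fun t => ∫ x, (S b).indicator P (t, x)) t = _
    rw [heq, integral_indicator measurableSet_Ioo]

/-- **The class-budget enstrophy bound on a closed slab in Tao's class** (Miller 2019, Thm. 1.1,
localised to the fast velocity class; slab form — hypotheses and constant as in the module
docstring): for all `s ∈ [0, T]`, `∫|∇u(s)|²_F ≤ (∫|∇u(0)|²_F + 1 + 2 max C 0) exp((2κ + 1) Λ)`.
[cite: Miller2019, Thm 1.1 (proof of Thm 5.2) and Lemma 5.1] -/
theorem classBudget_enstrophy_slab {ν T : ℝ} (hν : 0 < ν) (hT : 0 < T)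
    {u : ℝ → EuclideanSpace ℝ (Fin 3) → EuclideanSpace ℝ (Fin 3)}
    {p : ℝ → EuclideanSpace ℝ (Fin 3) → ℝ} (hsol : FluidPDE.IsClassicalNSSolutionOn (Icc 0 T) ν 0 u p)
    (hu : HasBoundedSobolevNormsOn (Icc 0 T) u)
    (hut : HasBoundedSobolevNormsOn (Icc 0 T) (FluidPDE.timeDerivWithin (Icc 0 T) u))
    (hp : ∀ n : ℕ, ∃ C : ℝ≥0, ∀ t ∈ Icc 0 T, ∫⁻ x, ‖iteratedFDeriv ℝ n (p t) x‖ₑ ^ 2 ≤ C)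
    {l : ℝ} (hl : 0 < l) {C : ℝ}
    (hslowI : IntegrableOn (fun z : ℝ × EuclideanSpace ℝ (Fin 3) =>
      ⟪curl (u z.1) z.2, fderiv ℝ (u z.1) z.2 (curl (u z.1) z.2)⟫)
      {z : ℝ × EuclideanSpace ℝ (Fin 3) | z.1 ∈ Ioo 0 T ∧ ‖u z.1 z.2‖ ≤ l})
    (hslow : ∀ b ∈ Ioc 0 T, ∫ z in {z : ℝ × EuclideanSpace ℝ (Fin 3) | z.1 ∈ Ioo 0 b ∧ ‖u z.1 z.2‖ ≤ l},
      ⟪curl (u z.1) z.2, fderiv ℝ (u z.1) z.2 (curl (u z.1) z.2)⟫ ≤ C)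
    {r : ℝ} (hr : 3 / 2 < r) {m : ℝ → EuclideanSpace ℝ (Fin 3) → ℝ} (hm0 : ∀ t x, 0 ≤ m t x)
    (hcl : ∀ t ∈ Ioo 0 T, ∀ x, l < ‖u t x‖ → ∃ a b : EuclideanSpace ℝ (Fin 3),
      ‖a‖ = 1 ∧ ‖b‖ = 1 ∧ ⟪a, b⟫ = 0 ∧
      ∀ α β : ℝ, ⟪fderiv ℝ (u t) x (α • a + β • b), α • a + β • b⟫ ≤ m t x * (α ^ 2 + β ^ 2))
    (hΛ : ∫⁻ t in Ioo 0 T, (∫⁻ x in {x | l < ‖u t x‖}, ENNReal.ofReal (m t x) ^ r) ^ (2 / (2 * r - 3)) ≠ ⊤) :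
    ∀ s ∈ Icc 0 T, ∫ x, frobeniusNormSq (fderiv ℝ (u s) x) ≤
      ((∫ x, frobeniusNormSq (fderiv ℝ (u 0) x)) + 1 + 2 * max C 0) *
        Real.exp ((2 * ((1 - 3 / (2 * r)) * (2 * (1 - (1 - 3 / (2 * r)))) ^ ((1 - (1 - 3 / (2 * r))) / (1 - 3 / (2 * r))) * ν ^ (-((1 - (1 - 3 / (2 * r))) / (1 - 3 / (2 * r))))) * (2 * ((SNormLESNormFDerivOfEqConst (EuclideanSpace ℝ (Fin 3)) (volume : Measure (EuclideanSpace ℝ (Fin 3))) 2 : ℝ) ^ (2 * (1 - (1 - 3 / (2 * r)))))) ^ (1 / (1 - 3 / (2 * r))) + 1) *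
          (∫⁻ t in Ioo 0 T, (∫⁻ x in {x | l < ‖u t x‖}, ENNReal.ofReal (m t x) ^ r) ^ (2 / (2 * r - 3))).toReal) := by
  set e := EuclideanSpace.basisFun (Fin 3) ℝ with he
  set KS : ℝ := (SNormLESNormFDerivOfEqConst (EuclideanSpace ℝ (Fin 3))
    (volume : Measure (EuclideanSpace ℝ (Fin 3))) 2 : ℝ) with hKS
  set θ : ℝ := 1 - 3 / (2 * r) with hθ
  set Cθ : ℝ := θ * (2 * (1 - θ)) ^ ((1 - θ) / θ) * ν ^ (-((1 - θ) / θ)) with hCθ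
  set κ : ℝ := Cθ * (2 * KS ^ (2 * (1 - θ))) ^ (1 / θ) with hκ
  have hr0 : 0 < r := by linarith
  have hθ0 : 0 < θ := by
    rw [hθ, sub_pos, div_lt_one (by positivity)]; linarith
  have hθ1 : θ < 1 := by
    rw [hθ]; linarith [div_pos (zero_lt_three' ℝ) (by positivity : (0 : ℝ) < 2 * r)]
  have h1θ : 0 < 1 - θ := by linarith
  have hKS0 : 0 ≤ KS := NNReal.coe_nonneg _
  have hCθ0 : 0 ≤ Cθ := by positivity
  have hκ0 : 0 ≤ κ := by positivity
  have hexp : 1 / r * (1 / θ) = 2 / (2 * r - 3) := by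
    rw [hθ]; field_simp
  have hU : UniqueDiffOn ℝ (Icc 0 T) := uniqueDiffOn_Icc hT
  set W : ℝ → EuclideanSpace ℝ (Fin 3) → EuclideanSpace ℝ (Fin 3) :=
    FluidPDE.timeDerivWithin (Icc 0 T) u with hW
  have hWsm : FluidPDE.IsSmoothSpaceTimeOn (Icc 0 T) W := hsol.smooth_velocity.timeDerivWithin hU
  -- pointwise bounds on `u` and `∇u` over the slab (Sobolev)
  obtain ⟨B₀, hB₀⟩ := linfty_bound_of_hasBoundedSobolevNormsOn_holds
    (fun t ht => (hsol.contDiff_velocity ht).of_le (by norm_cast)) hu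
  obtain ⟨K₀, -, hK₀⟩ := exists_forall_norm_fderiv_le_of_hasBoundedSobolevNormsOn
    (fun t ht => (hsol.contDiff_velocity ht).of_le (by norm_cast)) hu
  obtain ⟨C₁, hC₁⟩ := hu 1
  obtain ⟨D₂, hD₂⟩ := hu 2
  obtain ⟨D₃, hD₃⟩ := hu 3
  obtain ⟨E₀, hE₀⟩ := hut 0
  obtain ⟨E₁, hE₁⟩ := hut 1
  obtain ⟨P₀, hP₀⟩ := hp 0
  obtain ⟨P₁, hP₁⟩ := hp 1
  have hzero : ∀ {f : EuclideanSpace ℝ (Fin 3) → EuclideanSpace ℝ (Fin 3)} {C' : ℝ≥0},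
      (∫⁻ x, ‖iteratedFDeriv ℝ 0 f x‖ₑ ^ 2 ≤ C') → ∫⁻ x, ‖f x‖ₑ ^ 2 < ⊤ := by
    intro f C' h
    refine lt_of_le_of_lt ((le_of_eq (lintegral_congr fun x => ?_)).trans h) ENNReal.coe_lt_top
    rw [← ofReal_norm, ← ofReal_norm, norm_iteratedFDeriv_zero]
  have hzero' : ∀ {f : EuclideanSpace ℝ (Fin 3) → ℝ} {C' : ℝ≥0},
      (∫⁻ x, ‖iteratedFDeriv ℝ 0 f x‖ₑ ^ 2 ≤ C') → ∫⁻ x, ‖f x‖ₑ ^ 2 < ⊤ := by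
    intro f C' h
    refine lt_of_le_of_lt ((le_of_eq (lintegral_congr fun x => ?_)).trans h) ENNReal.coe_lt_top
    rw [← ofReal_norm, ← ofReal_norm, norm_iteratedFDeriv_zero]
  -- the enstrophy balance
  obtain ⟨hΦint, hGcont, hGb⟩ := hsol.smooth_velocity.enstrophy_balance hT hC₁ hE₁
  set Φ : ℝ → ℝ := fun t => ∫ x, 2 * ∑ i, ⟪fderiv ℝ (u t) x (e i), fderiv ℝ (W t) x (e i)⟫ with hΦ
  set G : ℝ → ℝ := fun t => ∫ x, FluidPDE.frobeniusNormSq (fderiv ℝ (u t) x) with hG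
  have hG0 : ∀ t, 0 ≤ G t := fun t => integral_nonneg fun x => FluidPDE.frobeniusNormSq_nonneg _
  have hfrob_le : ∀ t ∈ Icc 0 T,
      ∫⁻ x, ENNReal.ofReal (FluidPDE.frobeniusNormSq (fderiv ℝ (u t) x)) ≤ 3 * C₁ := by
    intro t ht
    calc ∫⁻ x, ENNReal.ofReal (FluidPDE.frobeniusNormSq (fderiv ℝ (u t) x))
        ≤ ∫⁻ x, 3 * ‖iteratedFDeriv ℝ 1 (u t) x‖ₑ ^ 2 := lintegral_mono fun x => by
          rw [← ofReal_norm, norm_iteratedFDeriv_one, ofReal_norm]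
          exact ofReal_frobeniusNormSq_le_three_mul_enorm_sq _
      _ = 3 * ∫⁻ x, ‖iteratedFDeriv ℝ 1 (u t) x‖ₑ ^ 2 := lintegral_const_mul' _ _ (by norm_num)
      _ ≤ 3 * C₁ := by gcongr; exact hC₁ t ht
  have hfrob_lt : ∀ t ∈ Icc 0 T,
      ∫⁻ x, ENNReal.ofReal (FluidPDE.frobeniusNormSq (fderiv ℝ (u t) x)) < ⊤ := fun t ht =>
    lt_of_le_of_lt (hfrob_le t ht) (ENNReal.mul_lt_top (by norm_num) ENNReal.coe_lt_top)
  have ifrob : ∀ t ∈ Icc 0 T, Integrable (fun x => FluidPDE.frobeniusNormSq (fderiv ℝ (u t) x)) volume :=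
    fun t ht => integrable_of_continuous_of_nonneg
      (FluidPDE.continuous_frobeniusNormSq_fderiv (hsol.contDiff_velocity ht) (by simp))
      (fun x => FluidPDE.frobeniusNormSq_nonneg _) (hfrob_lt t ht)
  have hGeq : ∀ t ∈ Icc 0 T, ENNReal.ofReal (G t) =
      ∫⁻ x, ENNReal.ofReal (FluidPDE.frobeniusNormSq (fderiv ℝ (u t) x)) := fun t ht =>
    ofReal_integral_eq_lintegral_ofReal (ifrob t ht)
      (Eventually.of_forall fun x => FluidPDE.frobeniusNormSq_nonneg _)
  have hGle : ∀ t ∈ Icc 0 T, G t ≤ (3 * (C₁ : ℝ≥0∞)).toReal := by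
    intro t ht
    have h := (hGeq t ht).trans_le (hfrob_le t ht)
    exact (ENNReal.ofReal_le_iff_le_toReal (ENNReal.mul_ne_top (by norm_num) ENNReal.coe_ne_top)).1 h
  -- the slow class: Fubini
  set Pst : ℝ × EuclideanSpace ℝ (Fin 3) → ℝ := fun z =>
    ⟪curl (u z.1) z.2, fderiv ℝ (u z.1) z.2 (curl (u z.1) z.2)⟫ with hPst
  set hslowf : ℝ → ℝ := fun t => ∫ x in {x | ‖u t x‖ ≤ l}, Pst (t, x) with hhslowf
  obtain ⟨hhint, hfub⟩ := slowClass_fubini hsol.smooth_velocity.continuousOn (P := Pst) (l := l) hslowI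
  have hslow' : ∀ b ∈ Ioc 0 T, ∫ t in Ioo 0 b, hslowf t ≤ C := by
    intro b hb
    rw [hhslowf, ← hfub b hb]
    exact hslow b hb
  -- the fast-class charge `A(t)` and the kernel `a(t) = 2κ A(t)`
  set A : ℝ → ℝ≥0∞ := fun t =>
    (∫⁻ x in {x | l < ‖u t x‖}, ENNReal.ofReal (m t x) ^ r) ^ (2 / (2 * r - 3)) with hA
  set aE : ℝ → ℝ≥0∞ := fun t => ENNReal.ofReal (2 * κ + 1) * A t with haE
  -- the class ledger at interior times: `ofReal (Φ t - 2 h t) ≤ a t * ofReal (G t + 1)`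
  have hslice : ∀ t ∈ Ioo 0 T, ENNReal.ofReal (Φ t - 2 * hslowf t) ≤ aE t * ENNReal.ofReal (G t + 1) := by
    intro t ht
    have htI : t ∈ Icc 0 T := Ioo_subset_Icc_self ht
    by_cases hfin : ∫⁻ x in {x | l < ‖u t x‖}, ENNReal.ofReal (m t x) ^ r < ⊤
    · -- the charge is finite: the slice lemma applies
      have hmom : ∀ x, W t x + FluidPDE.convect (u t) (u t) x = ν • (Δ (u t)) x - gradient (p t) x := by
        intro x
        have h := hsol.momentum t htI x
        simpa [hW] using h
      have hsl := classLedger_slice hν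
        ((hsol.contDiff_velocity htI).of_le (by norm_cast))
        ((hWsm.contDiff_slice htI).of_le (by norm_cast))
        ((hsol.contDiff_pressure htI).of_le (by norm_cast)) hmom (hsol.divFree t htI)
        (fun x => hB₀ t htI x) (fun x => hK₀ t htI x)
        ((hC₁ t htI).trans_lt ENNReal.coe_lt_top) ((hD₂ t htI).trans_lt ENNReal.coe_lt_top)
        ((hD₃ t htI).trans_lt ENNReal.coe_lt_top)
        (hzero (hE₀ t htI)) ((hE₁ t htI).trans_lt ENNReal.coe_lt_top)
        (hzero' (hP₀ t htI)) ((hP₁ t htI).trans_lt ENNReal.coe_lt_top)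
        hl (hm0 t) (hcl t ht) hr hfin
      -- `N^{1/θ} = A.toReal`
      set N : ℝ := ((∫⁻ x in {x | l < ‖u t x‖}, ENNReal.ofReal (m t x) ^ r) ^ (1 / r)).toReal with hN
      have hN0 : 0 ≤ N := ENNReal.toReal_nonneg
      have hNA : N ^ (1 / θ) = (A t).toReal := by
        rw [hN, hA, ENNReal.toReal_rpow, ← ENNReal.rpow_mul, hexp]
      have hconst : Cθ * (2 * N * KS ^ (2 * (1 - θ))) ^ (1 / θ) = κ * (A t).toReal := by
        rw [hκ, ← hNA, show 2 * N * KS ^ (2 * (1 - θ)) = N * (2 * KS ^ (2 * (1 - θ))) by ring,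
          Real.mul_rpow hN0 (by positivity)]
        ring
      have h2 : Φ t = 2 * ∫ x, ∑ i, ⟪fderiv ℝ (u t) x (e i), fderiv ℝ (W t) x (e i)⟫ := by
        rw [hΦ]; exact integral_const_mul _ _
      have hreal : Φ t - 2 * hslowf t ≤ (2 * κ + 1) * (A t).toReal * (G t + 1) := by
        have h3 : ∫ x, ∑ i, ⟪fderiv ℝ (u t) x (e i), fderiv ℝ (W t) x (e i)⟫ ≤
            hslowf t + κ * (A t).toReal * G t := by
          have h := hsl
          rw [← he, hconst] at h
          simpa [hhslowf, hPst, hG, mul_assoc] using h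
        have hAG : 0 ≤ κ * (A t).toReal := mul_nonneg hκ0 ENNReal.toReal_nonneg
        have hA0 : 0 ≤ (A t).toReal := ENNReal.toReal_nonneg
        nlinarith [h3, hAG, hG0 t, mul_nonneg hA0 (hG0 t), hA0]
      calc ENNReal.ofReal (Φ t - 2 * hslowf t) ≤ ENNReal.ofReal ((2 * κ + 1) * (A t).toReal * (G t + 1)) :=
            ENNReal.ofReal_le_ofReal hreal
        _ = aE t * ENNReal.ofReal (G t + 1) := by
            rw [haE]; simp only
            have h2κ : 0 ≤ 2 * κ + 1 := by linarith [hκ0]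
            rw [ENNReal.ofReal_mul (mul_nonneg h2κ ENNReal.toReal_nonneg), ENNReal.ofReal_mul h2κ,
              ENNReal.ofReal_toReal (ENNReal.rpow_ne_top_of_nonneg
                (div_nonneg zero_le_two (by linarith)) hfin.ne)]
    · -- the charge is infinite: the right-hand side is `⊤`
      have htop : ∫⁻ x in {x | l < ‖u t x‖}, ENNReal.ofReal (m t x) ^ r = ⊤ :=
        top_le_iff.1 (not_lt.1 hfin)
      have hAt : A t = ⊤ := by
        rw [hA]; simp only
        rw [htop, ENNReal.top_rpow_of_pos (div_pos two_pos (by linarith))]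
      have hκpos : 0 < 2 * κ + 1 := by linarith [hκ0]
      have h1 : aE t = ⊤ := by
        rw [haE]; simp only
        rw [hAt, ENNReal.mul_top (by simpa using hκpos)]
      rw [h1, ENNReal.top_mul (by have := hG0 t; simp; linarith)]
      exact le_top
  -- Grönwall in `ℝ≥0∞` for `ψ = G + 1`
  set ψE : ℝ → ℝ≥0∞ := fun t => ENNReal.ofReal (G t + 1) with hψE
  have hM : ∀ t ∈ Icc 0 T, ψE t ≤ 3 * C₁ + 1 := fun t ht => by
    rw [hψE]; simp only
    rw [ENNReal.ofReal_add (hG0 t) zero_le_one, ENNReal.ofReal_one, hGeq t ht]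
    exact add_le_add (hfrob_le t ht) le_rfl
  have haT : ∫⁻ t in Ioo 0 T, aE t ≠ ⊤ := by
    rw [haE]; simp only
    rw [lintegral_const_mul' _ _ ENNReal.ofReal_ne_top]
    exact ENNReal.mul_ne_top ENNReal.ofReal_ne_top hΛ
  set Bc : ℝ := G 0 + 1 + 2 * max C 0 with hBc
  have hBc0 : 0 ≤ Bc := by have := hG0 0; positivity
  have hineq : ∀ t ∈ Icc 0 T, ψE t ≤ ENNReal.ofReal Bc + ∫⁻ τ in Ioo 0 t, aE τ * ψE τ := by
    intro t ht
    rcases eq_or_lt_of_le ht.1 with h0 | ht0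
    · rw [← h0, hψE, hBc]; simp only
      refine (ENNReal.ofReal_le_ofReal (by have := le_max_right C 0; linarith)).trans le_self_add
    have htT : t ∈ Ioc 0 T := ⟨ht0, ht.2⟩
    -- `G t = G 0 + ∫ (Φ - 2h) + 2 ∫ h`
    have hΦt : IntegrableOn Φ (Ioo 0 t) volume := hΦint.mono_set (Ioo_subset_Ioo le_rfl ht.2)
    have hht : IntegrableOn hslowf (Ioo 0 t) volume := hhint.mono_set (Ioo_subset_Ioo le_rfl ht.2)
    have hdec : ∫ τ in Ioo 0 t, Φ τ = (∫ τ in Ioo 0 t, (Φ τ - 2 * hslowf τ)) + 2 * ∫ τ in Ioo 0 t, hslowf τ := by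
      rw [integral_sub hΦt (hht.const_mul 2), integral_const_mul]; ring
    -- `ofReal (∫ (Φ - 2h)) ≤ ∫⁻ a ψ`
    have hΦh : IntegrableOn (fun τ => Φ τ - 2 * hslowf τ) (Ioo 0 t) volume := hΦt.sub (hht.const_mul 2)
    have h1 : ENNReal.ofReal (∫ τ in Ioo 0 t, (Φ τ - 2 * hslowf τ)) ≤
        ∫⁻ τ in Ioo 0 t, ENNReal.ofReal (Φ τ - 2 * hslowf τ) := by
      calc ENNReal.ofReal (∫ τ in Ioo 0 t, (Φ τ - 2 * hslowf τ))
          ≤ ENNReal.ofReal (∫ τ in Ioo 0 t, max (Φ τ - 2 * hslowf τ) 0) :=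
            ENNReal.ofReal_le_ofReal (integral_mono hΦh hΦh.pos_part fun τ => le_max_left _ _)
        _ = ∫⁻ τ in Ioo 0 t, ENNReal.ofReal (max (Φ τ - 2 * hslowf τ) 0) :=
            ofReal_integral_eq_lintegral_ofReal hΦh.pos_part (Eventually.of_forall fun τ => le_max_right _ _)
        _ = ∫⁻ τ in Ioo 0 t, ENNReal.ofReal (Φ τ - 2 * hslowf τ) := lintegral_congr fun τ => by
            rcases le_total (Φ τ - 2 * hslowf τ) 0 with h | h
            · rw [max_eq_right h, ENNReal.ofReal_zero, ENNReal.ofReal_of_nonpos h]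
            · rw [max_eq_left h]
    have h2 : ∫⁻ τ in Ioo 0 t, ENNReal.ofReal (Φ τ - 2 * hslowf τ) ≤ ∫⁻ τ in Ioo 0 t, aE τ * ψE τ :=
      setLIntegral_mono' measurableSet_Ioo fun τ hτ => hslice τ ⟨hτ.1, hτ.2.trans_le ht.2⟩
    have h3 : 2 * ∫ τ in Ioo 0 t, hslowf τ ≤ 2 * max C 0 :=
      mul_le_mul_of_nonneg_left ((hslow' t htT).trans (le_max_left _ _)) zero_le_two
    have hGt : G t = G 0 + ((∫ τ in Ioo 0 t, (Φ τ - 2 * hslowf τ)) + 2 * ∫ τ in Ioo 0 t, hslowf τ) := by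
      have h := hGb t htT
      rw [intervalIntegral.integral_of_le ht.1, integral_Ioc_eq_integral_Ioo] at h
      rw [← hdec]
      exact h
    calc ψE t = ENNReal.ofReal (G 0 + 1 + 2 * (∫ τ in Ioo 0 t, hslowf τ) +
          ∫ τ in Ioo 0 t, (Φ τ - 2 * hslowf τ)) := by
          rw [hψE]; simp only
          rw [hGt]
          congr 1; ring
      _ ≤ ENNReal.ofReal (Bc + ∫ τ in Ioo 0 t, (Φ τ - 2 * hslowf τ)) := by
          refine ENNReal.ofReal_le_ofReal ?_
          rw [hBc]; linarith
      _ ≤ ENNReal.ofReal Bc + ENNReal.ofReal (∫ τ in Ioo 0 t, (Φ τ - 2 * hslowf τ)) := ENNReal.ofReal_add_le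
      _ ≤ ENNReal.ofReal Bc + ∫⁻ τ in Ioo 0 t, aE τ * ψE τ := by gcongr; exact h1.trans h2
  have hgron := lintegral_gronwall_le (S := T) ENNReal.ofReal_ne_top
    (ENNReal.add_ne_top.2 ⟨ENNReal.mul_ne_top (by norm_num) ENNReal.coe_ne_top, ENNReal.one_ne_top⟩)
    hM haT hineq
  -- unpack
  intro s hs
  have hs' := hgron s hs
  have haS : (∫⁻ τ in Ioo 0 s, aE τ) ≤ ∫⁻ τ in Ioo 0 T, aE τ := lintegral_mono_set (Ioo_subset_Ioo le_rfl hs.2)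
  have haS_fin : (∫⁻ τ in Ioo 0 s, aE τ) ≠ ⊤ := ne_top_of_le_ne_top haT haS
  have hint_a : (∫⁻ τ in Ioo 0 T, aE τ).toReal = (2 * κ + 1) * (∫⁻ t in Ioo 0 T, A t).toReal := by
    rw [haE]; simp only
    rw [lintegral_const_mul' _ _ ENNReal.ofReal_ne_top, ENNReal.toReal_mul, ENNReal.toReal_ofReal (by positivity)]
  have hexp_le : Real.exp ((∫⁻ τ in Ioo 0 s, aE τ).toReal) ≤
      Real.exp ((2 * κ + 1) * (∫⁻ t in Ioo 0 T, A t).toReal) := by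
    rw [← hint_a]
    exact Real.exp_le_exp.2 (ENNReal.toReal_mono haT haS)
  have hfin : ENNReal.ofReal Bc * ENNReal.ofReal (Real.exp ((∫⁻ τ in Ioo 0 s, aE τ).toReal)) ≠ ⊤ :=
    ENNReal.mul_ne_top ENNReal.ofReal_ne_top ENNReal.ofReal_ne_top
  have hreal : G s + 1 ≤ Bc * Real.exp ((∫⁻ τ in Ioo 0 s, aE τ).toReal) := by
    have h := (ENNReal.ofReal_le_iff_le_toReal hfin).1 hs'
    rwa [ENNReal.toReal_mul, ENNReal.toReal_ofReal hBc0, ENNReal.toReal_ofReal (Real.exp_nonneg _)] at h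
  have hκeq : 2 * κ + 1 = 2 * ((1 - 3 / (2 * r)) * (2 * (1 - (1 - 3 / (2 * r)))) ^ ((1 - (1 - 3 / (2 * r))) / (1 - 3 / (2 * r))) * ν ^ (-((1 - (1 - 3 / (2 * r))) / (1 - 3 / (2 * r))))) * (2 * KS ^ (2 * (1 - (1 - 3 / (2 * r))))) ^ (1 / (1 - 3 / (2 * r))) + 1 := by
    rw [hκ, hCθ, hθ]; ring
  calc G s ≤ G s + 1 := by linarith
    _ ≤ Bc * Real.exp ((∫⁻ τ in Ioo 0 s, aE τ).toReal) := hreal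
    _ ≤ Bc * Real.exp ((2 * κ + 1) * (∫⁻ t in Ioo 0 T, A t).toReal) := mul_le_mul_of_nonneg_left hexp_le hBc0
    _ = _ := by rw [hBc, hκeq, hA]

/-- **The class-budget enstrophy bound on a closed slab, registered helper-stub form** (the
`∀`-closed statement of `classBudget_enstrophy_slab`). [cite: Miller2019, Thm 1.1 (proof of Thm 5.2) and Lemma 5.1] -/
theorem class_budget_slab :
    ∀ (ν T : ℝ), 0 < ν → 0 < T → ∀ (u : ℝ → EuclideanSpace ℝ (Fin 3) → EuclideanSpace ℝ (Fin 3))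
      (p : ℝ → EuclideanSpace ℝ (Fin 3) → ℝ), IsClassicalNSSolutionOn (Set.Icc 0 T) ν 0 u p →
      HasBoundedSobolevNormsOn (Set.Icc 0 T) u →
      HasBoundedSobolevNormsOn (Set.Icc 0 T) (FluidPDE.timeDerivWithin (Set.Icc 0 T) u) →
      (∀ n : ℕ, ∃ C : NNReal, ∀ t ∈ Set.Icc 0 T, ∫⁻ x, ‖iteratedFDeriv ℝ n (p t) x‖ₑ ^ 2 ≤ C) →
      ∀ l : ℝ, 0 < l → ∀ C : ℝ,
      MeasureTheory.IntegrableOn (fun z : ℝ × EuclideanSpace ℝ (Fin 3) =>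
        inner ℝ (curl (u z.1) z.2) (fderiv ℝ (u z.1) z.2 (curl (u z.1) z.2)))
        {z : ℝ × EuclideanSpace ℝ (Fin 3) | z.1 ∈ Set.Ioo 0 T ∧ ‖u z.1 z.2‖ ≤ l} →
      (∀ b ∈ Set.Ioc 0 T, ∫ z in {z : ℝ × EuclideanSpace ℝ (Fin 3) | z.1 ∈ Set.Ioo 0 b ∧ ‖u z.1 z.2‖ ≤ l},
        inner ℝ (curl (u z.1) z.2) (fderiv ℝ (u z.1) z.2 (curl (u z.1) z.2)) ≤ C) →
      ∀ r : ℝ, 3 / 2 < r → ∀ m : ℝ → EuclideanSpace ℝ (Fin 3) → ℝ, (∀ t x, 0 ≤ m t x) →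
      (∀ t ∈ Set.Ioo 0 T, ∀ x, l < ‖u t x‖ → ∃ a b : EuclideanSpace ℝ (Fin 3),
        ‖a‖ = 1 ∧ ‖b‖ = 1 ∧ inner ℝ a b = 0 ∧
        ∀ α β : ℝ, inner ℝ (fderiv ℝ (u t) x (α • a + β • b)) (α • a + β • b) ≤ m t x * (α ^ 2 + β ^ 2)) →
      ((∫⁻ t in Set.Ioo 0 T, (∫⁻ x in {x | l < ‖u t x‖}, ENNReal.ofReal (m t x) ^ r) ^ (2 / (2 * r - 3))) ≠ ⊤) →
      ∀ s ∈ Set.Icc 0 T, ∫ x, frobeniusNormSq (fderiv ℝ (u s) x) ≤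
        ((∫ x, frobeniusNormSq (fderiv ℝ (u 0) x)) + 1 + 2 * max C 0) * Real.exp ((2 * ((1 - 3 / (2 * r)) * (2 * (1 - (1 - 3 / (2 * r)))) ^ ((1 - (1 - 3 / (2 * r))) / (1 - 3 / (2 * r))) * ν ^ (-((1 - (1 - 3 / (2 * r))) / (1 - 3 / (2 * r))))) * (2 * ((SNormLESNormFDerivOfEqConst (EuclideanSpace ℝ (Fin 3)) (MeasureTheory.volume : MeasureTheory.Measure (EuclideanSpace ℝ (Fin 3))) 2 : ℝ) ^ (2 * (1 - (1 - 3 / (2 * r)))))) ^ (1 / (1 - 3 / (2 * r))) + 1) * (∫⁻ t in Set.Ioo 0 T, (∫⁻ x in {x | l < ‖u t x‖}, ENNReal.ofReal (m t x) ^ r) ^ (2 / (2 * r - 3))).toReal) := by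
  intro ν T hν hT u p hsol hu hut hp l hl C hI hslow r hr m hm0 hcl hΛ
  exact classBudget_enstrophy_slab hν hT hsol hu hut hp hl hI hslow hr hm0 hcl hΛ

end Summit.NavierStokesRegularity.NavierStokesRegularity.Theorems.ClassBudgetsRegularise

end
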